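import Mathlib
import HarnessLib
import Literature.MathematicalPhysics.QuantumFieldTheory.FariaDaVeigaOCarroll2022.FdVOC22MultiReflectionBound
import Literature.MathematicalPhysics.QuantumFieldTheory.LatticeGaugeProofs
import Literature.MathematicalPhysics.QuantumLattice.CloverPseudoscalarParity
import Literature.MathematicalPhysics.QuantumLattice.CloverObservables

/-!
# Reflection positivity makes the clover-charge correlator NON-POSITIVE across every reflection plane: `⟨P_x P_{θx}⟩ ≤ 0`, and the time-slice charges satisfy `⟨Q_t Q_{t'}⟩ ≤ 0` for reflected slices

HONEST FRAMING: exact (Metropolis-corrected) sampling algorithms for lattice gauge theory;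
figures of merit are autocorrelation/cost numbers at stated couplings and volumes; no
continuum-physics claim.

Venture `LatticeQCDFlow` (cell pub-lqcd), topic `Exactness`, FANOUT row 21 (`su3-base`: both arms estimate the topological
susceptibility from the clover charge `Q = Σ_x P_x/(8π²)`, and the open-boundary arm reads it from SLAB charges `Q_t = Σ_{x₀=t} P_x`;
row 21's `Scoring/TranslationAverageTwoPoint` wrote `E[Q²] = |Λ| Σ_v E[P_0 P_v]` and left the SIGN of the two-point function
open).  NEW WORK of the cell over the Literature's Osterwalder–Seiler reflection positivity of the Wilson plaquette measure on
even tori — link reflection `θ(t) = 1 − t` for `β ≥ 0` (`FariaDaVeigaOCarroll2022.integral_mul_timeReflect_nonneg`) and site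
reflection `θ'(t) = −t` for every `β` (`integral_mul_negReflect_nonneg`) — and the Literature's parity of the bare clover
pseudoscalar density (`CloverPseudoscalarParity.cloverPseudoscalar_reflect`: `P` is ODD under time reflections).  Def-free;
nothing is cited as a fact; no number.  Printed counterpart, NAMED ONLY: Aguado–Seiler 2005 §1 / Seiler–Stamatescu (reflection
positivity forces the pseudoscalar two-point function to be ≤ 0 away from contact) — here on the FINITE periodic lattice, for
the purely temporal separations the torus reflections provide, any compact `G`, any continuous unitary `ρ`, `d = 4`.

* §1 `cloverPseudoscalar_timeReflect` / `cloverPseudoscalar_negReflect` — `P_x(ΘU) = −P_{θx}(U)` for both reflections of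
  configurations (the Literature lemma instantiated on the torus `(ℤ/L)⁴`).
* §2 SUPPORT: the clover at a site of time `m` lives on the slices `m − 1, m, m + 1` (`cloverEdges_zero_time_mem`,
  `cloverEdges_spatial_time_eq`); hence **`dependsOn_cloverPseudoscalar_posEdges`** (`2 ≤ m ≤ L/2 − 1`: an observable of the
  positive-time links of the link reflection) and **`dependsOn_cloverPseudoscalar_sitePosEdges`** (`1 ≤ m ≤ L/2 − 1`: of the
  site-positive and shared links of the site reflection).
* §3 **`integral_sum_cloverPseudoscalar_mul_sum_timeReflect_nonpos`** / **`…_negReflect_nonpos`** — for EVERY finite real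
  combination `F = Σ_k c_k P_{y_k}` supported in the positive half: `∫ F · (Σ_k c_k P_{θy_k}) dμ_β ≤ 0` (the OS form
  `⟨F·ΘF⟩ ≥ 0` with `ΘP = −P∘θ`); singletons **`integral_cloverPseudoscalar_mul_timeReflect_nonpos`** (`⟨P_x P_{θx}⟩ ≤ 0`,
  `β ≥ 0`) and **`integral_cloverPseudoscalar_mul_negReflect_nonpos`** (`⟨P_x P_{θ'x}⟩ ≤ 0`, every `β`).
* §4 SLABS: `sum_slab_timeReflect` / `sum_slab_negReflect` (re-indexing a reflected slice) and
  **`integral_slabCharge_mul_slabCharge_timeReflect_nonpos`** (`⟨Q_m Q_{1−m}⟩_β ≤ 0`, `2 ≤ m ≤ L/2 − 1`, `β ≥ 0`: odd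
  separations `3 … L − 3`), **`integral_slabCharge_mul_slabCharge_negReflect_nonpos`** (`⟨Q_m Q_{−m}⟩_β ≤ 0`,
  `1 ≤ m ≤ L/2 − 1`, every `β`: even separations `2 … L − 2`).
In words: on the periodic lattice the charge two-point function and the slab-charge correlator are non-positive at every
purely temporal separation `2 ≤ |s| ≤ L − 2` that the two reflections reach from their planes; only the contact slabs
`|s| ≤ 1` can carry the (positive) susceptibility.  NOT CLAIMED: spatial or mixed separations of single densities (no rotation
symmetry is used); the flowed / cooled charge (its footprint grows with the smoothing radius — the support hypothesis of §2 then
needs the corresponding distance from the plane, not typed here); the translation to arbitrary slice pairs `(t, t + s)` and the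
resulting bound of `E[Q²]` by its contact terms (sequel); odd `L`; numbers.
-/
noncomputable section

namespace Summit.Ventures.LatticeQCDFlow.Exactness

open MeasureTheory
open Literature.MathematicalPhysics.QuantumFieldTheory
open Literature.MathematicalPhysics.QuantumLattice (cloverPseudoscalar cloverPseudoscalar_reflect
  continuous_cloverPseudoscalar measurable_cloverPseudoscalar exists_abs_cloverPseudoscalar_le cloverEdges
  flowedClover_zero_congr)

/-! ## §1 The two time reflections act on the clover charge density by a sign -/

section Reflections

variable {L N : ℕ} {G : Type*} [Group G] (ρ : G →* Matrix (Fin N) (Fin N) ℂ)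

/-- `θ(y + e₀) = θy − e₀` for the link reflection `θ(t) = 1 − t`. -/
theorem timeReflect_add_single_zero (y : Site 4 L) :
    (y + Pi.single (0 : Fin 4) 1).timeReflect = y.timeReflect - Pi.single (0 : Fin 4) 1 := by
  funext k
  by_cases hk : k = 0
  · subst hk; simp [Site.timeReflect]
  · simp [Site.timeReflect, hk]

/-- `θ(y + eᵢ) = θy + eᵢ` for `i ≠ 0` (link reflection). -/
theorem timeReflect_add_single_of_ne (y : Site 4 L) {i : Fin 4} (hi : i ≠ 0) :
    (y + Pi.single i 1).timeReflect = y.timeReflect + Pi.single i 1 := by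
  funext k
  by_cases hk : k = 0
  · subst hk; simp [Site.timeReflect, hi.symm]
  · simp [Site.timeReflect, hk]

/-- `θ'(y + e₀) = θ'y − e₀` for the site reflection `θ'(t) = −t`. -/
theorem negReflect_add_single_zero (y : Site 4 L) :
    (y + Pi.single (0 : Fin 4) 1).negReflect = y.negReflect - Pi.single (0 : Fin 4) 1 := by
  funext k
  by_cases hk : k = 0
  · subst hk; simp [Site.negReflect]; ring
  · simp [Site.negReflect, hk]

/-- `θ'(y + eᵢ) = θ'y + eᵢ` for `i ≠ 0` (site reflection). -/
theorem negReflect_add_single_of_ne (y : Site 4 L) {i : Fin 4} (hi : i ≠ 0) :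
    (y + Pi.single i 1).negReflect = y.negReflect + Pi.single i 1 := by
  funext k
  by_cases hk : k = 0
  · subst hk; simp [Site.negReflect, hi.symm]
  · simp [Site.negReflect, hk]

/-- **`P_x(ΘU) = −P_{θx}(U)`**: the clover charge density is ODD under the Osterwalder–Seiler link reflection `Θ` of
configurations (unitary `ρ`). -/
theorem cloverPseudoscalar_timeReflect (hρ : ∀ g, ρ g ∈ Matrix.unitaryGroup (Fin N) ℂ) (U : GaugeConfig 4 L G)
    (x : Site 4 L) :
    cloverPseudoscalar ρ x U.timeReflect = -cloverPseudoscalar ρ (Site.timeReflect x) U :=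
  cloverPseudoscalar_reflect ρ hρ (Site.timeReflect (d := 4) (L := L)) (timeReflect_add_single_zero (L := L))
    (fun y _ hi => timeReflect_add_single_of_ne (L := L) y hi) U U.timeReflect
    (fun y => by unfold GaugeConfig.timeReflect; rw [if_pos rfl]; rfl)
    (fun y _ hi => by unfold GaugeConfig.timeReflect; rw [if_neg hi]) x

/-- **`P_x(Θ'U) = −P_{θ'x}(U)`**: the clover charge density is ODD under the site reflection `Θ'`. -/
theorem cloverPseudoscalar_negReflect (hρ : ∀ g, ρ g ∈ Matrix.unitaryGroup (Fin N) ℂ) (U : GaugeConfig 4 L G)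
    (x : Site 4 L) :
    cloverPseudoscalar ρ x U.negReflect = -cloverPseudoscalar ρ (Site.negReflect x) U :=
  cloverPseudoscalar_reflect ρ hρ (Site.negReflect (d := 4) (L := L)) (negReflect_add_single_zero (L := L))
    (fun y _ hi => negReflect_add_single_of_ne (L := L) y hi) U U.negReflect
    (fun y => by unfold GaugeConfig.negReflect; rw [if_pos rfl]; rfl)
    (fun y _ hi => by unfold GaugeConfig.negReflect; rw [if_neg hi]) x

end Reflections

/-! ## §2 Support: the clover at a site of time `m` lives on the slices `m − 1, m, m + 1` -/

section Support

variable {L N : ℕ} {G : Type*} [Group G] (ρ : G →* Matrix (Fin N) (Fin N) ℂ)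

/-- `P_x` depends only on the links of the six plane clovers through `x`: planes `(0, i)` and `(i, j)`, `i, j ≠ 0`. -/
theorem cloverPseudoscalar_congr_planes {U V : GaugeConfig 4 L G} {x : Site 4 L}
    (h0 : ∀ i : Fin 4, i ≠ 0 → ∀ e ∈ cloverEdges x 0 i, U e = V e)
    (hs : ∀ i j : Fin 4, i ≠ 0 → j ≠ 0 → i ≠ j → ∀ e ∈ cloverEdges x i j, U e = V e) :
    cloverPseudoscalar ρ x U = cloverPseudoscalar ρ x V := by
  have h01 := flowedClover_zero_congr ρ (h0 1 (by decide))
  have h02 := flowedClover_zero_congr ρ (h0 2 (by decide))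
  have h03 := flowedClover_zero_congr ρ (h0 3 (by decide))
  have h23 := flowedClover_zero_congr ρ (hs 2 3 (by decide) (by decide) (by decide))
  have h13 := flowedClover_zero_congr ρ (hs 1 3 (by decide) (by decide) (by decide))
  have h12 := flowedClover_zero_congr ρ (hs 1 2 (by decide) (by decide) (by decide))
  rw [Literature.MathematicalPhysics.QuantumLattice.cloverPseudoscalar_def,
    Literature.MathematicalPhysics.QuantumLattice.cloverPseudoscalar_def, h01, h02, h03, h23, h13, h12]

/-- Links of the `(0, i)` clover through `x`: endpoint times in `{x₀ − 1, x₀, x₀ + 1}`, temporal links start at `x₀ − 1` or `x₀`. -/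
theorem cloverEdges_zero_time_mem (x : Site 4 L) {i : Fin 4} (hi : i ≠ 0) {e : Edge 4 L} (he : e ∈ cloverEdges x 0 i) :
    e.1 0 ∈ ({x 0 - 1, x 0, x 0 + 1} : Finset (ZMod L)) ∧ (e.2 = 0 → e.1 0 ∈ ({x 0 - 1, x 0} : Finset (ZMod L))) ∧
      (e.1.shift e.2) 0 ∈ ({x 0 - 1, x 0, x 0 + 1} : Finset (ZMod L)) := by
  simp only [cloverEdges, Finset.mem_insert, Finset.mem_singleton] at he
  rcases he with rfl | rfl | rfl | rfl | rfl | rfl | rfl | rfl | rfl | rfl | rfl | rfl <;>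
    simp [Site.shift, hi, Ne.symm hi, Finset.mem_insert, Finset.mem_singleton, sub_eq_add_neg, add_comm, add_left_comm]

/-- Links of a spatial `(i, j)` clover through `x`: all endpoints at time `x₀`, none temporal. -/
theorem cloverEdges_spatial_time_eq (x : Site 4 L) {i j : Fin 4} (hi : i ≠ 0) (hj : j ≠ 0) {e : Edge 4 L}
    (he : e ∈ cloverEdges x i j) : e.1 0 = x 0 ∧ e.2 ≠ 0 ∧ (e.1.shift e.2) 0 = x 0 := by
  simp only [cloverEdges, Finset.mem_insert, Finset.mem_singleton] at he
  rcases he with rfl | rfl | rfl | rfl | rfl | rfl | rfl | rfl | rfl | rfl | rfl | rfl <;>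
    simp [Site.shift, hi, hj, Ne.symm hi, Ne.symm hj]

/-- Time values on the three slices: `(x₀ − 1).val = m − 1`, `x₀.val = m`, `(x₀ + 1).val = m + 1` (`x₀ = m`, `1 ≤ m`, `m + 1 < L`). -/
theorem val_slices [NeZero L] {x : Site 4 L} {m : ℕ} (hx : x 0 = m) (h1 : 1 ≤ m) (hL : m + 1 < L) :
    (x 0 - 1).val = m - 1 ∧ (x 0).val = m ∧ (x 0 + 1).val = m + 1 := by
  refine ⟨?_, ?_, ?_⟩
  · rw [hx, show ((m : ℕ) : ZMod L) - 1 = ((m - 1 : ℕ) : ZMod L) by push_cast [Nat.cast_sub h1]; ring,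
      ZMod.val_natCast, Nat.mod_eq_of_lt (by omega)]
  · rw [hx, ZMod.val_natCast, Nat.mod_eq_of_lt (by omega)]
  · rw [hx, show ((m : ℕ) : ZMod L) + 1 = ((m + 1 : ℕ) : ZMod L) by push_cast; ring,
      ZMod.val_natCast, Nat.mod_eq_of_lt hL]

/-- Time values of the members of the three-slice set. -/
theorem val_mem_slices [NeZero L] {x : Site 4 L} {m : ℕ} (hx : x 0 = m) (h1 : 1 ≤ m) (hL : m + 1 < L) {t : ZMod L}
    (ht : t ∈ ({x 0 - 1, x 0, x 0 + 1} : Finset (ZMod L))) : m - 1 ≤ t.val ∧ t.val ≤ m + 1 := by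
  obtain ⟨ha, hb, hc⟩ := val_slices hx h1 hL
  simp only [Finset.mem_insert, Finset.mem_singleton] at ht
  rcases ht with rfl | rfl | rfl
  · rw [ha]; omega
  · rw [hb]; omega
  · rw [hc]; omega

/-- **THE CLOVER CHARGE DENSITY AT TIME `m`, `2 ≤ m ≤ L/2 − 1`, IS AN OBSERVABLE OF THE POSITIVE-TIME LINKS** `Λ₊ = {1 ≤ t ≤ L/2}`
of the link reflection. -/
theorem dependsOn_cloverPseudoscalar_posEdges [NeZero L] (x : Site 4 L) {m : ℕ} (hx : x 0 = m) (h2 : 2 ≤ m)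
    (hm : m + 1 ≤ L / 2) (hL : m + 1 < L) :
    DependsOn (fun U : GaugeConfig 4 L G => cloverPseudoscalar ρ x U) {e : Edge 4 L | WilsonRP.IsPosEdge e} := by
  intro U V hUV
  refine cloverPseudoscalar_congr_planes ρ (fun i hi e he => hUV e ?_) (fun i j hi hj hij e he => hUV e ?_)
  · obtain ⟨hb, -, hf⟩ := cloverEdges_zero_time_mem x hi he
    obtain ⟨hb1, hb2⟩ := val_mem_slices hx (by omega) hL hb
    obtain ⟨hf1, hf2⟩ := val_mem_slices hx (by omega) hL hf
    exact ⟨by omega, by omega, by omega, by omega⟩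
  · obtain ⟨hb, -, hf⟩ := cloverEdges_spatial_time_eq x hi hj he
    obtain ⟨-, hv, -⟩ := val_slices hx (by omega) hL
    refine ⟨?_, ?_, ?_, ?_⟩ <;> simp only [hb, hf, hv] <;> omega

/-- **THE CLOVER CHARGE DENSITY AT TIME `m`, `1 ≤ m ≤ L/2 − 1`, IS AN OBSERVABLE OF THE SITE-POSITIVE AND SHARED LINKS** of
the site reflection (temporal links from `t < L/2`, spatial links at `1 ≤ t < L/2` or in the planes `t = 0`, `t = L/2`). -/
theorem dependsOn_cloverPseudoscalar_sitePosEdges [NeZero L] (x : Site 4 L) {m : ℕ} (hx : x 0 = m) (h1 : 1 ≤ m)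
    (hm : m + 1 ≤ L / 2) (hL : m + 1 < L) :
    DependsOn (fun U : GaugeConfig 4 L G => cloverPseudoscalar ρ x U)
      ((WilsonSiteRP.sitePosEdges ∪ WilsonSiteRP.sharedEdges : Finset (Edge 4 L)) : Set (Edge 4 L)) := by
  intro U V hUV
  refine cloverPseudoscalar_congr_planes ρ (fun i hi e he => hUV e ?_) (fun i j hi hj hij e he => hUV e ?_)
  · obtain ⟨hb, ht, -⟩ := cloverEdges_zero_time_mem x hi he
    simp only [Finset.coe_union, Set.mem_union, Finset.mem_coe, WilsonSiteRP.mem_sitePosEdges,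
      WilsonSiteRP.mem_sharedEdges, WilsonSiteRP.IsSitePosEdge, WilsonSiteRP.IsSharedEdge]
    obtain ⟨hva, hvb, -⟩ := val_slices hx h1 hL
    by_cases he0 : e.2 = 0
    · have h2 := ht he0
      simp only [Finset.mem_insert, Finset.mem_singleton] at h2
      left; rw [if_pos he0]; rcases h2 with h2 | h2 <;> [rw [h2, hva]; rw [h2, hvb]] <;> omega
    · obtain ⟨hb1, hb2⟩ := val_mem_slices hx h1 hL hb
      rw [if_neg he0]
      by_cases hlo : (e.1 0).val = 0
      · right; exact ⟨he0, Or.inl hlo⟩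
      by_cases hhi : (e.1 0).val = L / 2
      · right; exact ⟨he0, Or.inr hhi⟩
      · left; omega
  · obtain ⟨hb, hne, -⟩ := cloverEdges_spatial_time_eq x hi hj he
    obtain ⟨-, hv, -⟩ := val_slices hx h1 hL
    simp only [Finset.coe_union, Set.mem_union, Finset.mem_coe, WilsonSiteRP.mem_sitePosEdges,
      WilsonSiteRP.mem_sharedEdges, WilsonSiteRP.IsSitePosEdge, WilsonSiteRP.IsSharedEdge]
    left; rw [if_neg hne, hb, hv]; omega

end Support
/-! ## §3 Reflection positivity: the charge correlator across a reflection plane is non-positive -/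

section Positivity

variable {L N : ℕ} [NeZero L] [Fact (1 < L)] {G : Type*} [Group G] [TopologicalSpace G] [IsTopologicalGroup G]
  [CompactSpace G] [MeasurableSpace G] [BorelSpace G] [SecondCountableTopology G]
  (ρ : G →* Matrix (Fin N) (Fin N) ℂ)

omit [Fact (1 < L)] [IsTopologicalGroup G] in
/-- A finite real combination of clover charge densities is measurable and bounded. -/
theorem measurable_bounded_sum_cloverPseudoscalar (hρc : Continuous ρ) {ι : Type*} (s : Finset ι) (c : ι → ℝ)
    (y : ι → Site 4 L) :
    Measurable (fun U : GaugeConfig 4 L G => ∑ k ∈ s, c k * cloverPseudoscalar ρ (y k) U) ∧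
      ∃ K : ℝ, ∀ U : GaugeConfig 4 L G, |∑ k ∈ s, c k * cloverPseudoscalar ρ (y k) U| ≤ K := by
  refine ⟨Finset.measurable_sum s fun k _ => (measurable_cloverPseudoscalar ρ hρc (y k)).const_mul (c k), ?_⟩
  choose C hC using fun k => exists_abs_cloverPseudoscalar_le ρ hρc (R := ZMod L) (y k)
  refine ⟨∑ k ∈ s, |c k| * C k, fun U => (Finset.abs_sum_le_sum_abs _ _).trans (Finset.sum_le_sum fun k _ => ?_)⟩
  rw [abs_mul]
  exact mul_le_mul_of_nonneg_left (hC k U) (abs_nonneg _)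

/-- **LINK REFLECTION POSITIVITY FOR CHARGE DENSITIES** (even `L`, `β ≥ 0`, continuous unitary `ρ`): for every finite
real combination `F = Σ_k c_k P_{y_k}` of clover charge densities at sites of times `2 ≤ (y_k)₀ ≤ L/2 − 1`,
`∫ F · (Σ_k c_k P_{θ y_k}) dμ_β ≤ 0` — the Osterwalder–Seiler form `⟨F · ΘF⟩ ≥ 0` with `ΘP_y = −P_{θy}`. -/
theorem integral_sum_cloverPseudoscalar_mul_sum_timeReflect_nonpos (hL : Even L) (hρc : Continuous ρ)
    (hρu : ∀ g, ρ g ∈ Matrix.unitaryGroup (Fin N) ℂ) {β : ℝ} (hβ : 0 ≤ β) {ι : Type*} (s : Finset ι) (c : ι → ℝ)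
    (y : ι → Site 4 L) (hy : ∀ k ∈ s, ∃ m : ℕ, y k 0 = m ∧ 2 ≤ m ∧ m + 1 ≤ L / 2) :
    ∫ U, (∑ k ∈ s, c k * cloverPseudoscalar ρ (y k) U) *
        (∑ k ∈ s, c k * cloverPseudoscalar ρ (Site.timeReflect (y k)) U) ∂(wilsonMeasure ρ β) ≤ 0 := by
  have hL1 : 1 < L := Fact.out
  obtain ⟨hFm, hFb⟩ := measurable_bounded_sum_cloverPseudoscalar ρ hρc s c y
  have hFdep : DependsOn (fun U : GaugeConfig 4 L G => ∑ k ∈ s, c k * cloverPseudoscalar ρ (y k) U)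
      {e : Edge 4 L | WilsonRP.IsPosEdge e} := by
    intro U V hUV
    refine Finset.sum_congr rfl fun k hk => ?_
    obtain ⟨m, hm, h2, hmL⟩ := hy k hk
    have h := dependsOn_cloverPseudoscalar_posEdges ρ (y k) hm h2 hmL (by omega) hUV
    simp only at h
    rw [h]
  have key := FariaDaVeigaOCarroll2022.integral_mul_timeReflect_nonneg ρ hL hρc hβ hFm hFb hFdep
  have hrefl : ∀ U : GaugeConfig 4 L G, (∑ k ∈ s, c k * cloverPseudoscalar ρ (y k) U.timeReflect) =
      -∑ k ∈ s, c k * cloverPseudoscalar ρ (Site.timeReflect (y k)) U := by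
    intro U
    rw [← Finset.sum_neg_distrib]
    refine Finset.sum_congr rfl fun k _ => ?_
    rw [cloverPseudoscalar_timeReflect ρ hρu, mul_neg]
  simp only [hrefl, mul_neg, integral_neg] at key
  linarith


/-- **SITE REFLECTION POSITIVITY FOR CHARGE DENSITIES** (even `L`, EVERY real `β`, continuous unitary `ρ`): for every finite
real combination `F = Σ_k c_k P_{y_k}` at sites of times `1 ≤ (y_k)₀ ≤ L/2 − 1`, `∫ F · (Σ_k c_k P_{θ' y_k}) dμ_β ≤ 0`. -/
theorem integral_sum_cloverPseudoscalar_mul_sum_negReflect_nonpos (hL : Even L) (hρc : Continuous ρ)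
    (hρu : ∀ g, ρ g ∈ Matrix.unitaryGroup (Fin N) ℂ) (β : ℝ) {ι : Type*} (s : Finset ι) (c : ι → ℝ)
    (y : ι → Site 4 L) (hy : ∀ k ∈ s, ∃ m : ℕ, y k 0 = m ∧ 1 ≤ m ∧ m + 1 ≤ L / 2) :
    ∫ U, (∑ k ∈ s, c k * cloverPseudoscalar ρ (y k) U) *
        (∑ k ∈ s, c k * cloverPseudoscalar ρ (Site.negReflect (y k)) U) ∂(wilsonMeasure ρ β) ≤ 0 := by
  have hL1 : 1 < L := Fact.out
  obtain ⟨hFm, hFb⟩ := measurable_bounded_sum_cloverPseudoscalar ρ hρc s c y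
  have hFdep : DependsOn (fun U : GaugeConfig 4 L G => ∑ k ∈ s, c k * cloverPseudoscalar ρ (y k) U)
      ((WilsonSiteRP.sitePosEdges ∪ WilsonSiteRP.sharedEdges : Finset (Edge 4 L)) : Set (Edge 4 L)) := by
    intro U V hUV
    refine Finset.sum_congr rfl fun k hk => ?_
    obtain ⟨m, hm, h1, hmL⟩ := hy k hk
    have h := dependsOn_cloverPseudoscalar_sitePosEdges ρ (y k) hm h1 hmL (by omega) hUV
    simp only at h
    rw [h]
  have key := FariaDaVeigaOCarroll2022.integral_mul_negReflect_nonneg ρ hL hρc β hFm hFb hFdep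
  have hrefl : ∀ U : GaugeConfig 4 L G, (∑ k ∈ s, c k * cloverPseudoscalar ρ (y k) U.negReflect) =
      -∑ k ∈ s, c k * cloverPseudoscalar ρ (Site.negReflect (y k)) U := by
    intro U
    rw [← Finset.sum_neg_distrib]
    refine Finset.sum_congr rfl fun k _ => ?_
    rw [cloverPseudoscalar_negReflect ρ hρu, mul_neg]
  simp only [hrefl, mul_neg, integral_neg] at key
  linarith

/-- **`⟨P_x · P_{θx}⟩_β ≤ 0`** — a density against its link-reflected image (`2 ≤ x₀ ≤ L/2 − 1`, even `L`, `β ≥ 0`). -/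
theorem integral_cloverPseudoscalar_mul_timeReflect_nonpos (hL : Even L) (hρc : Continuous ρ)
    (hρu : ∀ g, ρ g ∈ Matrix.unitaryGroup (Fin N) ℂ) {β : ℝ} (hβ : 0 ≤ β) (x : Site 4 L) {m : ℕ} (hx : x 0 = m)
    (h2 : 2 ≤ m) (hm : m + 1 ≤ L / 2) :
    ∫ U, cloverPseudoscalar ρ x U * cloverPseudoscalar ρ (Site.timeReflect x) U ∂(wilsonMeasure ρ β) ≤ 0 := by
  have h := integral_sum_cloverPseudoscalar_mul_sum_timeReflect_nonpos ρ hL hρc hρu hβ ({(0 : Unit)} : Finset Unit)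
    (fun _ => 1) (fun _ => x) (fun _ _ => ⟨m, hx, h2, hm⟩)
  simpa using h

/-- **`⟨P_x · P_{θ'x}⟩_β ≤ 0`** — a density against its site-reflected image (`1 ≤ x₀ ≤ L/2 − 1`, even `L`, every `β`). -/
theorem integral_cloverPseudoscalar_mul_negReflect_nonpos (hL : Even L) (hρc : Continuous ρ)
    (hρu : ∀ g, ρ g ∈ Matrix.unitaryGroup (Fin N) ℂ) (β : ℝ) (x : Site 4 L) {m : ℕ} (hx : x 0 = m) (h1 : 1 ≤ m)
    (hm : m + 1 ≤ L / 2) :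
    ∫ U, cloverPseudoscalar ρ x U * cloverPseudoscalar ρ (Site.negReflect x) U ∂(wilsonMeasure ρ β) ≤ 0 := by
  have h := integral_sum_cloverPseudoscalar_mul_sum_negReflect_nonpos ρ hL hρc hρu β ({(0 : Unit)} : Finset Unit)
    (fun _ => 1) (fun _ => x) (fun _ _ => ⟨m, hx, h1, hm⟩)
  simpa using h

end Positivity

/-! ## §4 Slab charges: the time-slice charge correlator is non-positive across a reflection plane -/

section Slabs

variable {L N : ℕ} {G : Type*} [Group G] (ρ : G →* Matrix (Fin N) (Fin N) ℂ)

/-- The link reflection of sites is an involution. -/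
theorem site_timeReflect_timeReflect (x : Site 4 L) : Site.timeReflect (Site.timeReflect x) = x := by
  funext k
  by_cases hk : k = 0
  · subst hk; simp [Site.timeReflect]
  · simp [Site.timeReflect, hk]

/-- The site reflection of sites is an involution. -/
theorem site_negReflect_negReflect (x : Site 4 L) : Site.negReflect (Site.negReflect x) = x := by
  funext k
  by_cases hk : k = 0
  · subst hk; simp [Site.negReflect]
  · simp [Site.negReflect, hk]

variable [NeZero L]

/-- Reindexing the reflected slab: `Σ_{x : x₀ = t} P_{θx} = Σ_{x : x₀ = 1 − t} P_x`. -/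
theorem sum_slab_timeReflect (t : ZMod L) (f : Site 4 L → ℝ) :
    ∑ x ∈ Finset.univ.filter (fun x : Site 4 L => x 0 = t), f (Site.timeReflect x) =
      ∑ x ∈ Finset.univ.filter (fun x : Site 4 L => x 0 = 1 - t), f x := by
  refine Finset.sum_nbij' Site.timeReflect Site.timeReflect (fun x hx => ?_) (fun x hx => ?_)
    (fun x _ => site_timeReflect_timeReflect x) (fun x _ => site_timeReflect_timeReflect x) (fun x _ => rfl)
  · simp only [Finset.mem_filter, Finset.mem_univ, true_and] at hx ⊢
    simp [Site.timeReflect, hx]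
  · simp only [Finset.mem_filter, Finset.mem_univ, true_and] at hx ⊢
    simp [Site.timeReflect, hx]

/-- Reindexing the reflected slab: `Σ_{x : x₀ = t} P_{θ'x} = Σ_{x : x₀ = −t} P_x`. -/
theorem sum_slab_negReflect (t : ZMod L) (f : Site 4 L → ℝ) :
    ∑ x ∈ Finset.univ.filter (fun x : Site 4 L => x 0 = t), f (Site.negReflect x) =
      ∑ x ∈ Finset.univ.filter (fun x : Site 4 L => x 0 = -t), f x := by
  refine Finset.sum_nbij' Site.negReflect Site.negReflect (fun x hx => ?_) (fun x hx => ?_)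
    (fun x _ => site_negReflect_negReflect x) (fun x _ => site_negReflect_negReflect x) (fun x _ => rfl)
  · simp only [Finset.mem_filter, Finset.mem_univ, true_and] at hx ⊢
    simp [Site.negReflect, hx]
  · simp only [Finset.mem_filter, Finset.mem_univ, true_and] at hx ⊢
    simp [Site.negReflect, hx]

variable [Fact (1 < L)] [TopologicalSpace G] [IsTopologicalGroup G] [CompactSpace G] [MeasurableSpace G] [BorelSpace G]
  [SecondCountableTopology G]

/-- **THE SLAB-CHARGE CORRELATOR ACROSS THE LINK PLANE IS NON-POSITIVE**: `⟨Q_m · Q_{1−m}⟩_β ≤ 0`, `Q_t = Σ_{x : x₀ = t} P_x`,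
for `2 ≤ m ≤ L/2 − 1` (even `L`, `β ≥ 0`) — time separation `2m − 1 ∈ {3, 5, …, L − 3}`. -/
theorem integral_slabCharge_mul_slabCharge_timeReflect_nonpos (hL : Even L) (hρc : Continuous ρ)
    (hρu : ∀ g, ρ g ∈ Matrix.unitaryGroup (Fin N) ℂ) {β : ℝ} (hβ : 0 ≤ β) {m : ℕ} (h2 : 2 ≤ m) (hm : m + 1 ≤ L / 2) :
    ∫ U, (∑ x ∈ Finset.univ.filter (fun x : Site 4 L => x 0 = (m : ZMod L)), cloverPseudoscalar ρ x U) *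
        (∑ x ∈ Finset.univ.filter (fun x : Site 4 L => x 0 = 1 - (m : ZMod L)), cloverPseudoscalar ρ x U)
      ∂(wilsonMeasure ρ β) ≤ 0 := by
  have h := integral_sum_cloverPseudoscalar_mul_sum_timeReflect_nonpos ρ hL hρc hρu hβ
    (Finset.univ.filter (fun x : Site 4 L => x 0 = (m : ZMod L))) (fun _ => 1) id
    (fun x hx => ⟨m, by simpa using hx, h2, hm⟩)
  simp only [id, one_mul] at h
  have hre : ∀ U : GaugeConfig 4 L G,
      ∑ x ∈ Finset.univ.filter (fun x : Site 4 L => x 0 = (m : ZMod L)), cloverPseudoscalar ρ (Site.timeReflect x) U =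
        ∑ x ∈ Finset.univ.filter (fun x : Site 4 L => x 0 = 1 - (m : ZMod L)), cloverPseudoscalar ρ x U := fun U =>
    sum_slab_timeReflect (m : ZMod L) (fun x => cloverPseudoscalar ρ x U)
  simp only [hre] at h
  exact h

/-- **THE SLAB-CHARGE CORRELATOR ACROSS THE SITE PLANE IS NON-POSITIVE**: `⟨Q_m · Q_{−m}⟩_β ≤ 0` for
`1 ≤ m ≤ L/2 − 1` (even `L`, every `β`) — time separation `2m ∈ {2, 4, …, L − 2}`. -/
theorem integral_slabCharge_mul_slabCharge_negReflect_nonpos (hL : Even L) (hρc : Continuous ρ)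
    (hρu : ∀ g, ρ g ∈ Matrix.unitaryGroup (Fin N) ℂ) (β : ℝ) {m : ℕ} (h1 : 1 ≤ m) (hm : m + 1 ≤ L / 2) :
    ∫ U, (∑ x ∈ Finset.univ.filter (fun x : Site 4 L => x 0 = (m : ZMod L)), cloverPseudoscalar ρ x U) *
        (∑ x ∈ Finset.univ.filter (fun x : Site 4 L => x 0 = -(m : ZMod L)), cloverPseudoscalar ρ x U)
      ∂(wilsonMeasure ρ β) ≤ 0 := by
  have h := integral_sum_cloverPseudoscalar_mul_sum_negReflect_nonpos ρ hL hρc hρu β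
    (Finset.univ.filter (fun x : Site 4 L => x 0 = (m : ZMod L))) (fun _ => 1) id
    (fun x hx => ⟨m, by simpa using hx, h1, hm⟩)
  simp only [id, one_mul] at h
  have hre : ∀ U : GaugeConfig 4 L G,
      ∑ x ∈ Finset.univ.filter (fun x : Site 4 L => x 0 = (m : ZMod L)), cloverPseudoscalar ρ (Site.negReflect x) U =
        ∑ x ∈ Finset.univ.filter (fun x : Site 4 L => x 0 = -(m : ZMod L)), cloverPseudoscalar ρ x U := fun U =>
    sum_slab_negReflect (m : ZMod L) (fun x => cloverPseudoscalar ρ x U)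
  simp only [hre] at h
  exact h

end Slabs


end Summit.Ventures.LatticeQCDFlow.Exactness
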